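import Literature.Topology.FourManifolds.HCobordismTheoremProofs
import Literature.Topology.FourManifolds.SPC4HandlesCancelStep
import HarnessLib

/-!
# Two First Cancellations in two disjoint slabs

Topic `Literature/Topology/FourManifolds`; a proofs-only file (no definition, no named fact) over
Milnor's First Cancellation Theorem on a slab,
`Literature.Topology.FourManifolds.Cobordism.Milnor1965_firstCancellation_slab` (`HCobordismTradeStep.lean`,
PROVED as `Cobordism.Milnor1965_firstCancellation_slab_holds`, `HCobordismTheoremProofs.lean`).

Milnor, *Lectures on the h-cobordism theorem* (1965), Thm. 5.4 (PDF p. 27) cancels ONE pair of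
critical points `p`, `p'` of indices `λ`, `λ + 1` whose spheres `S_R(p)`, `S_L(p')` in an
intermediate level meet transversely in one point, altering `f` and `ξ` only on the slab
between them; the tree's slab form records exactly this (*"`f' = f` near `{f ∉ (a₀, a₁)}`,
`ξ' = ξ` off `f⁻¹(a₀, a₁)`, no critical points left in `f⁻¹[a₀, a₁]`"*).  When several
independent pairs are to be cancelled (as in the proof of Thm. 8.1, PDF pp. 54–57, or in the
cancellation of two `1`/`2`-handle pairs of a Kirby diagram, e.g. Oba 2016, §3.2), one applies
5.4 once per pair, each pair isolated in its own slab; the bookkeeping that the later slabs keep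
their critical points, values, indices AND HAND SPHERES through the earlier cancellations is
proved here once and for all, for two slabs:

* `Cobordism.exists_firstCancellation_slab_criticalSet` — 5.4 on one slab with the bookkeeping
  made explicit: the new critical set is the old one minus `{p, p'}`, with the old values and
  indices;
* `mem_stableSet_of_field_eq_of_apply_le_apply` — stable sets of points below a level depend
  only on the field below that level (companion of the tree's
  `mem_unstableSet_of_field_eq_of_apply_le`, `mem_stableSet_of_field_eq_of_le_apply`);
* `Cobordism.exists_firstCancellation_two_slabs` — **two pairs `(p, p')`, `(r, r')` alone in two
  disjoint slabs `f⁻¹[a₀, a₁]`, `f⁻¹[a₂, a₃]` (`a₁ < a₂`), each meeting the hypotheses of 5.4 in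
  a level of its slab, are cancelled by a Morse function `f''` with gradient-like `ξ''` which
  agree with `f`, `ξ` off the two open slabs, have no critical points in the two closed slabs
  (which they map into themselves), and whose critical set is that of `f` minus the four
  points, with the old values and indices.**  Proof: cancel the upper pair first; below the
  level `a₂` nothing has changed — the level `f = b`, the trajectories from `p` up to it and
  from it up to `p'` all lie in `{f ≤ a₁}` where `f₁ = f` and `ξ₁ = ξ` — so the lower slab
  still satisfies the hypotheses of 5.4, verbatim; cancel it.
* `criticalSetOfIndex_eq_sdiff_of_criticalSet_eq_sdiff` — per-index form of such a critical-set
  bookkeeping (any removed set);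
* `exists_isMorseAdapted_cancel_two_slabs` — **the same read on a compact manifold with
  boundary `W`**, presented as the triad `(W; ∅, ∂W)` (`Cobordism.ofBoundary`,
  `SPC4HandlesCancelStep.lean`): the result is a Morse function ADAPTED to `∂W` whose critical
  points are those of `g` minus the four cancelled ones, index by index; and
  `exists_isMorseAdapted_ncard_one_sub_two_of_two_slabs` — for two `k`/`(k+1)` pairs of indices
  `1`/`2` the number of critical points of index `1` drops by two and any bound on the indices of
  `g` persists (the form consumed by handle-counting arguments, e.g.
  `Oba2016_steinFilling_fourHoledSphere_of_isMorseAdapted_ncard_one_le_one`).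

## References

* J. Milnor, *Lectures on the h-cobordism theorem*, Princeton (1965), Thm. 5.4 (PDF p. 27),
  Def. 5.1 (PDF p. 26), proof of Thm. 8.1 (PDF pp. 54–57). [MilnorHCobordism1965]
* T. Oba, *Stein fillings of homology 3-spheres and mapping class groups*, Geom. Dedicata 183
  (2016), §3.2 (two cancelling `1`/`2`-handle pairs). [Oba2016]
-/

open Set Function Filter
open scoped Manifold Topology ContDiff

noncomputable section

namespace Literature.Topology.FourManifolds

universe u

/-! ### Stable sets below a level depend only on the field below that level -/

section Field

variable {E : Type*} [NormedAddCommGroup E] [NormedSpace ℝ E] {H : Type*} [TopologicalSpace H]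
  {I : ModelWithCorners ℝ E H} {M : Type*} [TopologicalSpace M] [ChartedSpace H M]
  {ξ ξ' : Π x : M, TangentSpace I x} {f : M → ℝ} {x q : M}

/-- **Stable sets of points below a level depend only on the field below that level**: if
`ξ(f) > 0` off the critical points of the differentiable `f`, `ξ'` agrees with `ξ` on
`{f ≤ a}` and `f q ≤ a`, then every point of the stable set of `q` for `ξ` lies on the stable
set of `q` for `ξ'` (the trajectory going to `q` stays in `{f ≤ f q} ⊆ {f ≤ a}`,
`apply_le_of_mem_stableSet`). [cite: MilnorHCobordism1965, Def. 3.1, Def. 3.9 (PDF p. 16), Lemma 4.7 (PDF p. 25)] -/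
theorem mem_stableSet_of_field_eq_of_apply_le_apply (hf : MDifferentiable I 𝓘(ℝ, ℝ) f)
    (hpos : ∀ y, ¬ IsMCriticalPt I f y → 0 < mlineDeriv I f y (ξ y)) {a : ℝ}
    (heq : ∀ w, f w ≤ a → ξ' w = ξ w) (hx : x ∈ stableSet I ξ q) (hqa : f q ≤ a) :
    x ∈ stableSet I ξ' q := by
  obtain ⟨γ, h0, hγ, hq⟩ := hx
  refine ⟨γ, h0, fun t ht => ?_, hq⟩
  have h1 : f (γ t) ≤ a :=
    (apply_le_of_mem_stableSet hf hpos (mem_stableSet_of_isMIntegralCurveOn hγ hq ht)).trans hqa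
  have h3 := hγ t ht
  rwa [← heq _ h1] at h3

end Field

/-! ### Thm. 5.4 on a slab, with the bookkeeping of the critical set -/

section Slabs

variable {n : ℕ} {M N : Type u} [TopologicalSpace M] [T2Space M] [SecondCountableTopology M]
  [ChartedSpace (EuclideanSpace ℝ (Fin n)) M] [IsManifold (𝓡 n) ∞ M] [CompactSpace M]
  [TopologicalSpace N] [T2Space N] [SecondCountableTopology N] [ChartedSpace (EuclideanSpace ℝ (Fin n)) N]
  [IsManifold (𝓡 n) ∞ N] [CompactSpace N] {c : Cobordism n M N}

/-- **Milnor 1965, Thm. 5.4 on a slab, with the bookkeeping of the critical set.**  In the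
setting of `Literature.Topology.FourManifolds.Cobordism.Milnor1965_firstCancellation_slab` (a Morse function `f` on the
cobordism `c` with smooth gradient-like `ξ`; in the slab `f⁻¹[a₀, a₁]`, `0 < a₀`, `a₁ < 1`,
the only critical points are `p` of index `k` and `p'` of index `k + 1`,
`a₀ < f p < b < f p' < a₁`, and in the level `f = b` the spheres `S_R(p)`, `S_L(p')` meet in
the single point `x₀`, transversely): there are a Morse function `f'` and a smooth
gradient-like `ξ'` for it with `f' = f` near `{f ∉ (a₀, a₁)}`, `ξ' = ξ` off `f⁻¹(a₀, a₁)`,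
`f'` mapping `f⁻¹[a₀, a₁]` into `[a₀, a₁]` without critical points there, **whose critical set
is that of `f` minus `{p, p'}`, every remaining critical point keeping its index and its
value**. [cite: MilnorHCobordism1965, Thm. 5.4 (PDF p. 27)] -/
theorem Cobordism.exists_firstCancellation_slab_criticalSet {f : c.W → ℝ}
    (hf : c.IsMorseFunction f)
    (ξ : Cₛ^∞⟮𝓡∂ (n + 1); EuclideanSpace ℝ (Fin (n + 1)), (TangentSpace (𝓡∂ (n + 1)) : c.W → Type)⟯)
    (hξ : IsGradientLike (𝓡∂ (n + 1)) f ξ) {a₀ a₁ b : ℝ} (ha₀ : 0 < a₀) (ha₁ : a₁ < 1)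
    {p p' : c.W} {k : ℕ}
    (hp : p ∈ criticalSetOfIndex (𝓡∂ (n + 1)) f k)
    (hp' : p' ∈ criticalSetOfIndex (𝓡∂ (n + 1)) f (k + 1))
    (h₁ : a₀ < f p) (h₂ : f p < b) (h₃ : b < f p') (h₄ : f p' < a₁)
    (honly : ∀ z ∈ criticalSet (𝓡∂ (n + 1)) f, f z ∈ Icc a₀ a₁ → z = p ∨ z = p') {x₀ : c.W}
    (hx₀ : rightHandSphere (𝓡∂ (n + 1)) f ξ p b ∩ leftHandSphere (𝓡∂ (n + 1)) f ξ p' b = {x₀})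
    (htr : IsTransverseInLevel (𝓡∂ (n + 1)) (f ⁻¹' {b}) (rightHandSphere (𝓡∂ (n + 1)) f ξ p b)
      (leftHandSphere (𝓡∂ (n + 1)) f ξ p' b) x₀) :
    ∃ f' : c.W → ℝ, ∃ ξ' : Cₛ^∞⟮𝓡∂ (n + 1); EuclideanSpace ℝ (Fin (n + 1)), (TangentSpace (𝓡∂ (n + 1)) : c.W → Type)⟯,
      c.IsMorseFunction f' ∧ IsGradientLike (𝓡∂ (n + 1)) f' ξ' ∧
      (∀ᶠ z in 𝓝ˢ {z | f z ∉ Ioo a₀ a₁}, f' z = f z) ∧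
      (∀ z, f z ∉ Ioo a₀ a₁ → ξ' z = ξ z) ∧
      (∀ z, f z ∈ Icc a₀ a₁ → f' z ∈ Icc a₀ a₁ ∧ ¬ IsMCriticalPt (𝓡∂ (n + 1)) f' z) ∧
      criticalSet (𝓡∂ (n + 1)) f' = criticalSet (𝓡∂ (n + 1)) f \ {p, p'} ∧
      (∀ z ∈ criticalSet (𝓡∂ (n + 1)) f',
        morseIndex (𝓡∂ (n + 1)) f' z = morseIndex (𝓡∂ (n + 1)) f z ∧ f' z = f z) := by
  obtain ⟨f', ξ', hf', hξ', hnear, hfield, hslab⟩ :=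
    Cobordism.Milnor1965_firstCancellation_slab_holds hf ξ hξ ha₀ ha₁ hp hp' h₁ h₂ h₃ h₄ honly
      hx₀ htr
  have hnear' : ∀ z, f z ∉ Icc a₀ a₁ → f' =ᶠ[𝓝 z] f := fun z hz => by
    have hzS : z ∈ {z | f z ∉ Ioo a₀ a₁} := fun h => hz (Ioo_subset_Icc_self h)
    exact hnear.filter_mono (nhds_le_nhdsSet hzS)
  have hpI : f p ∈ Icc a₀ a₁ := ⟨h₁.le, ((h₂.trans h₃).trans h₄).le⟩
  have hp'I : f p' ∈ Icc a₀ a₁ := ⟨((h₁.trans h₂).trans h₃).le, h₄.le⟩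
  have hcrit : criticalSet (𝓡∂ (n + 1)) f' = criticalSet (𝓡∂ (n + 1)) f \ {p, p'} := by
    ext z
    simp only [Set.mem_sdiff, mem_criticalSet, mem_insert_iff, mem_singleton_iff, not_or]
    by_cases hzI : f z ∈ Icc a₀ a₁
    · constructor
      · intro h; exact absurd h (hslab z hzI).2
      · rintro ⟨hz, hzp, hzq⟩
        exact ((honly z hz hzI).elim hzp hzq).elim
    · rw [isMCriticalPt_congr_of_eventuallyEq (hnear' z hzI)]
      constructor
      · intro hz
        refine ⟨hz, ?_, ?_⟩
        · rintro rfl; exact hzI hpI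
        · rintro rfl; exact hzI hp'I
      · exact fun h => h.1
  refine ⟨f', ξ', hf', hξ', hnear, hfield, hslab, hcrit, fun z hz => ?_⟩
  have hzI : f z ∉ Icc a₀ a₁ := by
    intro hzI
    have hz' := hz
    rw [hcrit] at hz'
    simp only [Set.mem_sdiff, mem_insert_iff, mem_singleton_iff, not_or] at hz'
    exact (honly z hz'.1 hzI).elim hz'.2.1 hz'.2.2
  exact ⟨morseIndex_congr_of_eventuallyEq (hnear' z hzI), (hnear' z hzI).self_of_nhds⟩

/-- **Two First Cancellations in two disjoint slabs.**  Let `f` be a Morse function on the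
cobordism `c` with smooth gradient-like `ξ`, and `0 < a₀`, `a₁ < a₂`, `a₃ < 1`.  Suppose the
only critical points of `f` in `f⁻¹[a₀, a₁]` are `p` of index `k` and `p'` of index `k + 1`,
`a₀ < f p < b < f p' < a₁`, with `S_R(p) ∩ S_L(p') = {x₀}` transversely in the level `f = b`;
and the only critical points in `f⁻¹[a₂, a₃]` are `r` of index `l` and `r'` of index `l + 1`,
`a₂ < f r < b' < f r' < a₃`, with `S_R(r) ∩ S_L(r') = {y₀}` transversely in the level
`f = b'`.  THEN there are a Morse function `f''` on `c` and a smooth gradient-like `ξ''` for it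
such that: `f'' = f` near `{f ∉ (a₀, a₁) ∪ (a₂, a₃)}` and `ξ'' = ξ` on that set; `f''` maps
`f⁻¹[a₀, a₁]` into `[a₀, a₁]` and `f⁻¹[a₂, a₃]` into `[a₂, a₃]` and has no critical point in
either; the critical set of `f''` is that of `f` minus `{p, p', r, r'}`; and every remaining
critical point keeps its index and its value.  (Thm. 5.4 twice: first on the upper slab; then
the level `f = b`, the trajectories from `p` up to it and from it up to `p'` lie in
`{f ≤ a₁}`, below the alteration, so the lower slab keeps its hypotheses verbatim.)
[cite: MilnorHCobordism1965, Thm. 5.4 (PDF p. 27), proof of Thm. 8.1 (PDF pp. 54–57)] -/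
theorem Cobordism.exists_firstCancellation_two_slabs {f : c.W → ℝ}
    (hf : c.IsMorseFunction f)
    (ξ : Cₛ^∞⟮𝓡∂ (n + 1); EuclideanSpace ℝ (Fin (n + 1)), (TangentSpace (𝓡∂ (n + 1)) : c.W → Type)⟯)
    (hξ : IsGradientLike (𝓡∂ (n + 1)) f ξ) {a₀ a₁ a₂ a₃ b b' : ℝ} (ha₀ : 0 < a₀)
    (ha₁₂ : a₁ < a₂) (ha₃ : a₃ < 1)
    {p p' r r' : c.W} {k l : ℕ}
    (hp : p ∈ criticalSetOfIndex (𝓡∂ (n + 1)) f k)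
    (hp' : p' ∈ criticalSetOfIndex (𝓡∂ (n + 1)) f (k + 1))
    (h₁ : a₀ < f p) (h₂ : f p < b) (h₃ : b < f p') (h₄ : f p' < a₁)
    (honly : ∀ z ∈ criticalSet (𝓡∂ (n + 1)) f, f z ∈ Icc a₀ a₁ → z = p ∨ z = p') {x₀ : c.W}
    (hx₀ : rightHandSphere (𝓡∂ (n + 1)) f ξ p b ∩ leftHandSphere (𝓡∂ (n + 1)) f ξ p' b = {x₀})
    (htr : IsTransverseInLevel (𝓡∂ (n + 1)) (f ⁻¹' {b}) (rightHandSphere (𝓡∂ (n + 1)) f ξ p b)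
      (leftHandSphere (𝓡∂ (n + 1)) f ξ p' b) x₀)
    (hr : r ∈ criticalSetOfIndex (𝓡∂ (n + 1)) f l)
    (hr' : r' ∈ criticalSetOfIndex (𝓡∂ (n + 1)) f (l + 1))
    (h₅ : a₂ < f r) (h₆ : f r < b') (h₇ : b' < f r') (h₈ : f r' < a₃)
    (honly' : ∀ z ∈ criticalSet (𝓡∂ (n + 1)) f, f z ∈ Icc a₂ a₃ → z = r ∨ z = r') {y₀ : c.W}
    (hy₀ : rightHandSphere (𝓡∂ (n + 1)) f ξ r b' ∩ leftHandSphere (𝓡∂ (n + 1)) f ξ r' b' = {y₀})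
    (htr' : IsTransverseInLevel (𝓡∂ (n + 1)) (f ⁻¹' {b'}) (rightHandSphere (𝓡∂ (n + 1)) f ξ r b')
      (leftHandSphere (𝓡∂ (n + 1)) f ξ r' b') y₀) :
    ∃ f'' : c.W → ℝ, ∃ ξ'' : Cₛ^∞⟮𝓡∂ (n + 1); EuclideanSpace ℝ (Fin (n + 1)), (TangentSpace (𝓡∂ (n + 1)) : c.W → Type)⟯,
      c.IsMorseFunction f'' ∧ IsGradientLike (𝓡∂ (n + 1)) f'' ξ'' ∧
      (∀ᶠ z in 𝓝ˢ {z | f z ∉ Ioo a₀ a₁ ∧ f z ∉ Ioo a₂ a₃}, f'' z = f z) ∧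
      (∀ z, f z ∉ Ioo a₀ a₁ → f z ∉ Ioo a₂ a₃ → ξ'' z = ξ z) ∧
      (∀ z, f z ∈ Icc a₀ a₁ → f'' z ∈ Icc a₀ a₁ ∧ ¬ IsMCriticalPt (𝓡∂ (n + 1)) f'' z) ∧
      (∀ z, f z ∈ Icc a₂ a₃ → f'' z ∈ Icc a₂ a₃ ∧ ¬ IsMCriticalPt (𝓡∂ (n + 1)) f'' z) ∧
      criticalSet (𝓡∂ (n + 1)) f'' = criticalSet (𝓡∂ (n + 1)) f \ {p, p', r, r'} ∧
      (∀ z ∈ criticalSet (𝓡∂ (n + 1)) f'',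
        morseIndex (𝓡∂ (n + 1)) f'' z = morseIndex (𝓡∂ (n + 1)) f z ∧ f'' z = f z) := by
  have ha₁ : a₁ < 1 := by linarith
  have ha₂ : 0 < a₂ := by linarith
  ----------------------------------------------------------------------------------------------
  -- Step 1: cancel the upper pair.
  ----------------------------------------------------------------------------------------------
  obtain ⟨f₁, ξ₁, hf₁, hξ₁, hnear₁, hfield₁, hslab₁, hcrit₁, hind₁⟩ :=
    Cobordism.exists_firstCancellation_slab_criticalSet hf ξ hξ ha₂ ha₃ hr hr' h₅ h₆ h₇ h₈ honly'
      hy₀ htr'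
  -- differentiability and positivity
  have hfd : MDifferentiable (𝓡∂ (n + 1)) 𝓘(ℝ, ℝ) f :=
    hf.isMorse.contMDiff.mdifferentiable (by simp)
  have hf₁d : MDifferentiable (𝓡∂ (n + 1)) 𝓘(ℝ, ℝ) f₁ :=
    hf₁.isMorse.contMDiff.mdifferentiable (by simp)
  have hpos := hξ.mlineDeriv_pos
  have hpos₁ := hξ₁.mlineDeriv_pos
  have hnn : ∀ w, 0 ≤ mlineDeriv (𝓡∂ (n + 1)) f w (ξ w) :=
    mlineDeriv_nonneg_of_pos_of_not_isMCriticalPt hpos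
  have hnn₁ : ∀ w, 0 ≤ mlineDeriv (𝓡∂ (n + 1)) f₁ w (ξ₁ w) :=
    mlineDeriv_nonneg_of_pos_of_not_isMCriticalPt hpos₁
  -- below `a₂` nothing has changed
  have hout : ∀ z, f z ∉ Ioo a₂ a₃ → f₁ z = f z := fun z hz => hnear₁.self_of_nhdsSet z hz
  have hlow : ∀ z, f z ≤ a₂ → f₁ z = f z := fun z hz => hout z fun h => (not_lt.2 hz) h.1
  have hlow₁ : ∀ z, f₁ z < a₂ → f₁ z = f z := by
    intro z hz
    refine hout z fun h => ?_
    have := (hslab₁ z (Ioo_subset_Icc_self h)).1.1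
    exact (not_lt.2 this) hz
  have hlowf : ∀ z, f₁ z < a₂ → f z < a₂ := fun z hz => by rwa [← hlow₁ z hz]
  have hξlow : ∀ w, f w ≤ a₂ → ξ₁ w = ξ w := fun w hw => hfield₁ w fun h => (not_lt.2 hw) h.1
  have hξlow₁ : ∀ a, a < a₂ → ∀ w, f₁ w ≤ a → ξ w = ξ₁ w := fun a ha w hw =>
    (hξlow w (hlowf w (hw.trans_lt ha)).le).symm
  -- the lower pair for `(f₁, ξ₁)`
  have hpa₂ : f p ≤ a₂ := by linarith
  have hp'a₂ : f p' ≤ a₂ := by linarith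
  have hpv : f₁ p = f p := hlow p hpa₂
  have hp'v : f₁ p' = f p' := hlow p' hp'a₂
  have hpr : p ≠ r := fun h => by subst h; linarith
  have hpr' : p ≠ r' := fun h => by subst h; linarith
  have hp'r : p' ≠ r := fun h => by subst h; linarith
  have hp'r' : p' ≠ r' := fun h => by subst h; linarith
  have hp₁c : p ∈ criticalSet (𝓡∂ (n + 1)) f₁ := by
    rw [hcrit₁]; exact ⟨hp.1, by simp [hpr, hpr']⟩
  have hp'₁c : p' ∈ criticalSet (𝓡∂ (n + 1)) f₁ := by
    rw [hcrit₁]; exact ⟨hp'.1, by simp [hp'r, hp'r']⟩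
  have hp₁ : p ∈ criticalSetOfIndex (𝓡∂ (n + 1)) f₁ k :=
    ⟨hp₁c, by rw [(hind₁ p hp₁c).1, hp.2]⟩
  have hp'₁ : p' ∈ criticalSetOfIndex (𝓡∂ (n + 1)) f₁ (k + 1) :=
    ⟨hp'₁c, by rw [(hind₁ p' hp'₁c).1, hp'.2]⟩
  have honly₁ : ∀ z ∈ criticalSet (𝓡∂ (n + 1)) f₁, f₁ z ∈ Icc a₀ a₁ → z = p ∨ z = p' := by
    intro z hz hzI
    have hzf : z ∈ criticalSet (𝓡∂ (n + 1)) f := by rw [hcrit₁] at hz; exact hz.1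
    rw [(hind₁ z hz).2] at hzI
    exact honly z hzf hzI
  -- the level `b` and the spheres in it are unchanged
  have hba₂ : b < a₂ := by linarith
  have hlev : f₁ ⁻¹' {b} = f ⁻¹' {b} := by
    ext z
    simp only [mem_preimage, mem_singleton_iff]
    constructor
    · intro h; rw [← hlow₁ z (by rw [h]; exact hba₂), h]
    · intro h; rw [hlow z (by rw [h]; exact hba₂.le), h]
  have hSR : rightHandSphere (𝓡∂ (n + 1)) f₁ ξ₁ p b = rightHandSphere (𝓡∂ (n + 1)) f ξ p b := by
    ext x
    simp only [mem_rightHandSphere_iff]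
    constructor
    · rintro ⟨hxu, hxb⟩
      have hxb' : f x = b := by rw [← hlow₁ x (by rw [hxb]; exact hba₂), hxb]
      exact ⟨mem_unstableSet_of_field_eq_of_apply_le hf₁d hnn₁ (hξlow₁ b hba₂) hxu hxb.le, hxb'⟩
    · rintro ⟨hxu, hxb⟩
      have hxb' : f₁ x = b := by rw [hlow x (by rw [hxb]; exact hba₂.le), hxb]
      exact ⟨mem_unstableSet_of_field_eq_of_apply_le hfd hnn hξlow hxu (by rw [hxb]; exact hba₂.le),
        hxb'⟩
  have hSL : leftHandSphere (𝓡∂ (n + 1)) f₁ ξ₁ p' b = leftHandSphere (𝓡∂ (n + 1)) f ξ p' b := by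
    ext x
    simp only [mem_leftHandSphere_iff]
    constructor
    · rintro ⟨hxs, hxb⟩
      have hxb' : f x = b := by rw [← hlow₁ x (by rw [hxb]; exact hba₂), hxb]
      refine ⟨mem_stableSet_of_field_eq_of_apply_le_apply hf₁d hpos₁
        (hξlow₁ (f₁ p') (by rw [hp'v]; linarith)) hxs le_rfl, hxb'⟩
    · rintro ⟨hxs, hxb⟩
      have hxb' : f₁ x = b := by rw [hlow x (by rw [hxb]; exact hba₂.le), hxb]
      exact ⟨mem_stableSet_of_field_eq_of_apply_le_apply hfd hpos hξlow hxs hp'a₂, hxb'⟩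
  have hx₀₁ : rightHandSphere (𝓡∂ (n + 1)) f₁ ξ₁ p b ∩ leftHandSphere (𝓡∂ (n + 1)) f₁ ξ₁ p' b =
      {x₀} := by rw [hSR, hSL, hx₀]
  have htr₁ : IsTransverseInLevel (𝓡∂ (n + 1)) (f₁ ⁻¹' {b})
      (rightHandSphere (𝓡∂ (n + 1)) f₁ ξ₁ p b) (leftHandSphere (𝓡∂ (n + 1)) f₁ ξ₁ p' b) x₀ := by
    rw [hlev, hSR, hSL]; exact htr
  ----------------------------------------------------------------------------------------------
  -- Step 2: cancel the lower pair.
  ----------------------------------------------------------------------------------------------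
  obtain ⟨f₂, ξ₂, hf₂, hξ₂, hnear₂, hfield₂, hslab₂, hcrit₂, hind₂⟩ :=
    Cobordism.exists_firstCancellation_slab_criticalSet hf₁ ξ₁ hξ₁ ha₀ ha₁ hp₁ hp'₁
      (by rw [hpv]; exact h₁) (by rw [hpv]; exact h₂) (by rw [hp'v]; exact h₃)
      (by rw [hp'v]; exact h₄) honly₁ hx₀₁ htr₁
  -- the lower slab of `f₁` is the lower slab of `f`
  have hIoo : ∀ z, f₁ z ∈ Ioo a₀ a₁ ↔ f z ∈ Ioo a₀ a₁ := by
    intro z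
    constructor
    · intro h; rwa [← hlow₁ z (h.2.trans ha₁₂)]
    · intro h; rwa [hlow z (h.2.trans ha₁₂).le]
  have hIcc : ∀ z, f₁ z ∈ Icc a₀ a₁ ↔ f z ∈ Icc a₀ a₁ := by
    intro z
    constructor
    · intro h; rwa [← hlow₁ z (h.2.trans_lt ha₁₂)]
    · intro h; rwa [hlow z (h.2.trans_lt ha₁₂).le]
  refine ⟨f₂, ξ₂, hf₂, hξ₂, ?_, ?_, ?_, ?_, ?_, ?_⟩
  · -- `f₂ = f` near `{f ∉ (a₀, a₁) ∪ (a₂, a₃)}`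
    have hsub₁ : {z : c.W | f z ∉ Ioo a₀ a₁ ∧ f z ∉ Ioo a₂ a₃} ⊆ {z | f₁ z ∉ Ioo a₀ a₁} :=
      fun z hz h => hz.1 ((hIoo z).1 h)
    have hsub₂ : {z : c.W | f z ∉ Ioo a₀ a₁ ∧ f z ∉ Ioo a₂ a₃} ⊆ {z | f z ∉ Ioo a₂ a₃} :=
      fun z hz => hz.2
    have e₁ := hnear₂.filter_mono (nhdsSet_mono hsub₁)
    have e₂ := hnear₁.filter_mono (nhdsSet_mono hsub₂)
    filter_upwards [e₁, e₂] with z hz₁ hz₂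
    rw [hz₁, hz₂]
  · -- `ξ₂ = ξ` off the two open slabs
    intro z hz hz'
    rw [hfield₂ z fun h => hz ((hIoo z).1 h), hfield₁ z hz']
  · -- the lower slab
    intro z hz
    exact hslab₂ z ((hIcc z).2 hz)
  · -- the upper slab
    intro z hz
    obtain ⟨hzI, hzc⟩ := hslab₁ z hz
    have hzo : f₁ z ∉ Icc a₀ a₁ := fun h => (not_lt.2 hzI.1) (h.2.trans_lt ha₁₂)
    have hnz : f₂ =ᶠ[𝓝 z] f₁ := by
      have hzS : z ∈ {z | f₁ z ∉ Ioo a₀ a₁} := fun h => hzo (Ioo_subset_Icc_self h)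
      exact hnear₂.filter_mono (nhds_le_nhdsSet hzS)
    refine ⟨?_, ?_⟩
    · rw [hnz.self_of_nhds]; exact hzI
    · rw [isMCriticalPt_congr_of_eventuallyEq hnz]; exact hzc
  · -- the critical set
    rw [hcrit₂, hcrit₁]
    ext z
    simp only [Set.mem_sdiff, mem_insert_iff, mem_singleton_iff, not_or]
    tauto
  · -- indices and values
    intro z hz
    have hz₁ : z ∈ criticalSet (𝓡∂ (n + 1)) f₁ := by rw [hcrit₂] at hz; exact hz.1
    rw [(hind₂ z hz).1, (hind₂ z hz).2, (hind₁ z hz₁).1, (hind₁ z hz₁).2]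
    exact ⟨rfl, rfl⟩

/-! ### Per-index bookkeeping -/

omit [T2Space M] [SecondCountableTopology M] [IsManifold (𝓡 n) ∞ M] [CompactSpace M]
  [T2Space N] [SecondCountableTopology N] [IsManifold (𝓡 n) ∞ N] [CompactSpace N] in
/-- **Per-index critical sets after a cancellation**: if the critical set of `g'` is that of `g`
minus a set `s`, every remaining critical point keeping its index, then for every `k` the
critical points of `g'` of index `k` are those of `g` of index `k` minus `s`. [folklore] -/
theorem criticalSetOfIndex_eq_sdiff_of_criticalSet_eq_sdiff {W : Type*} [TopologicalSpace W]
    [ChartedSpace (EuclideanHalfSpace (n + 1)) W] {g g' : W → ℝ} {s : Set W}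
    (hcrit : criticalSet (𝓡∂ (n + 1)) g' = criticalSet (𝓡∂ (n + 1)) g \ s)
    (hind : ∀ z ∈ criticalSet (𝓡∂ (n + 1)) g',
      morseIndex (𝓡∂ (n + 1)) g' z = morseIndex (𝓡∂ (n + 1)) g z) (k : ℕ) :
    criticalSetOfIndex (𝓡∂ (n + 1)) g' k = criticalSetOfIndex (𝓡∂ (n + 1)) g k \ s := by
  ext z
  simp only [mem_criticalSetOfIndex, Set.mem_sdiff]
  have hz : IsMCriticalPt (𝓡∂ (n + 1)) g' z ↔ IsMCriticalPt (𝓡∂ (n + 1)) g z ∧ z ∉ s := by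
    rw [← mem_criticalSet, hcrit]
    simp only [Set.mem_sdiff, mem_criticalSet]
  constructor
  · rintro ⟨hg', hk⟩
    have h := hz.1 hg'
    exact ⟨⟨h.1, by rw [← hind z hg', hk]⟩, h.2⟩
  · rintro ⟨⟨hgz, hk⟩, hzs⟩
    have hg' : IsMCriticalPt (𝓡∂ (n + 1)) g' z := hz.2 ⟨hgz, hzs⟩
    exact ⟨hg', by rw [hind z hg', hk]⟩

/-! ### Read on a compact manifold with boundary, as the triad `(W; ∅, ∂W)` -/

/-- **Two First Cancellations in two disjoint slabs, on a compact manifold with boundary.**  Let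
`W` be a compact manifold with boundary presented as the triad `(W; ∅, ∂W)`
(`Cobordism.ofBoundary n W`), `g` a Morse function on this triad (`≡ 1` exactly on `∂W`, values
in `(0, 1)` inside) with smooth gradient-like `ξ`, and two pairs `(p, p')`, `(r, r')` of
critical points of indices `k`/`k + 1`, `l`/`l + 1` alone in two disjoint slabs
`g⁻¹[a₀, a₁]`, `g⁻¹[a₂, a₃]` (`0 < a₀`, `a₁ < a₂`, `a₃ < 1`), each with
`S_R ∩ S_L = {pt}` transversely in a level of its slab.  Then `W` carries a Morse function
ADAPTED to `∂W` (`Literature.Topology.FourManifolds.IsMorseAdapted`) whose critical set is that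
of `g` minus `{p, p', r, r'}`, each remaining critical point keeping its index — so that for
every `j` its critical points of index `j` are those of `g` minus the four.
[cite: MilnorHCobordism1965, Thm. 5.4 (PDF p. 27), Def. 3.1, §1 Def. 1.3] -/
theorem exists_isMorseAdapted_cancel_two_slabs {W : Type u} [TopologicalSpace W] [T2Space W]
    [SecondCountableTopology W] [CompactSpace W] [ChartedSpace (EuclideanHalfSpace (n + 1)) W]
    [IsManifold (𝓡∂ (n + 1)) ∞ W] {g : W → ℝ}
    (hg : (Cobordism.ofBoundary n W).IsMorseFunction g)
    (ξ : Cₛ^∞⟮𝓡∂ (n + 1); EuclideanSpace ℝ (Fin (n + 1)), (TangentSpace (𝓡∂ (n + 1)) : W → Type)⟯)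
    (hξ : IsGradientLike (𝓡∂ (n + 1)) g ξ) {a₀ a₁ a₂ a₃ b b' : ℝ} (ha₀ : 0 < a₀)
    (ha₁₂ : a₁ < a₂) (ha₃ : a₃ < 1)
    {p p' r r' : W} {k l : ℕ}
    (hp : p ∈ criticalSetOfIndex (𝓡∂ (n + 1)) g k)
    (hp' : p' ∈ criticalSetOfIndex (𝓡∂ (n + 1)) g (k + 1))
    (h₁ : a₀ < g p) (h₂ : g p < b) (h₃ : b < g p') (h₄ : g p' < a₁)
    (honly : ∀ z ∈ criticalSet (𝓡∂ (n + 1)) g, g z ∈ Icc a₀ a₁ → z = p ∨ z = p') {x₀ : W}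
    (hx₀ : rightHandSphere (𝓡∂ (n + 1)) g ξ p b ∩ leftHandSphere (𝓡∂ (n + 1)) g ξ p' b = {x₀})
    (htr : IsTransverseInLevel (𝓡∂ (n + 1)) (g ⁻¹' {b}) (rightHandSphere (𝓡∂ (n + 1)) g ξ p b)
      (leftHandSphere (𝓡∂ (n + 1)) g ξ p' b) x₀)
    (hr : r ∈ criticalSetOfIndex (𝓡∂ (n + 1)) g l)
    (hr' : r' ∈ criticalSetOfIndex (𝓡∂ (n + 1)) g (l + 1))
    (h₅ : a₂ < g r) (h₆ : g r < b') (h₇ : b' < g r') (h₈ : g r' < a₃)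
    (honly' : ∀ z ∈ criticalSet (𝓡∂ (n + 1)) g, g z ∈ Icc a₂ a₃ → z = r ∨ z = r') {y₀ : W}
    (hy₀ : rightHandSphere (𝓡∂ (n + 1)) g ξ r b' ∩ leftHandSphere (𝓡∂ (n + 1)) g ξ r' b' = {y₀})
    (htr' : IsTransverseInLevel (𝓡∂ (n + 1)) (g ⁻¹' {b'}) (rightHandSphere (𝓡∂ (n + 1)) g ξ r b')
      (leftHandSphere (𝓡∂ (n + 1)) g ξ r' b') y₀) :
    ∃ f : W → ℝ, IsMorseAdapted (𝓡∂ (n + 1)) f ∧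
      criticalSet (𝓡∂ (n + 1)) f = criticalSet (𝓡∂ (n + 1)) g \ {p, p', r, r'} ∧
      (∀ z ∈ criticalSet (𝓡∂ (n + 1)) f, morseIndex (𝓡∂ (n + 1)) f z = morseIndex (𝓡∂ (n + 1)) g z) ∧
      (∀ j, criticalSetOfIndex (𝓡∂ (n + 1)) f j = criticalSetOfIndex (𝓡∂ (n + 1)) g j \ {p, p', r, r'}) := by
  haveI : CompactSpace ((𝓡∂ (n + 1)).boundary W) := compactSpace_boundary n W
  obtain ⟨f, ξ', hf, -, -, -, -, -, hcrit, hind⟩ :=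
    Cobordism.exists_firstCancellation_two_slabs (c := Cobordism.ofBoundary n W) hg ξ hξ ha₀ ha₁₂
      ha₃ hp hp' h₁ h₂ h₃ h₄ honly hx₀ htr hr hr' h₅ h₆ h₇ h₈ honly' hy₀ htr'
  have hind' : ∀ z ∈ criticalSet (𝓡∂ (n + 1)) f,
      morseIndex (𝓡∂ (n + 1)) f z = morseIndex (𝓡∂ (n + 1)) g z := fun z hz => (hind z hz).1
  exact ⟨f, hf.isMorseAdapted_ofBoundary, hcrit, hind',
    criticalSetOfIndex_eq_sdiff_of_criticalSet_eq_sdiff hcrit hind'⟩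

/-- **Counting form, for two `1`/`2` pairs**: in the setting of
`exists_isMorseAdapted_cancel_two_slabs` with both pairs of indices `1`/`2`, the adapted Morse
function obtained has exactly two critical points of index `1` fewer than `g`, the same
critical points of every index `j ∉ {1, 2}`, and no critical point of index above a bound `m`
if `g` has none. [cite: MilnorHCobordism1965, Thm. 5.4 (PDF p. 27); Oba2016, §3.2] -/
theorem exists_isMorseAdapted_ncard_one_sub_two_of_two_slabs {W : Type u} [TopologicalSpace W]
    [T2Space W] [SecondCountableTopology W] [CompactSpace W]
    [ChartedSpace (EuclideanHalfSpace (n + 1)) W] [IsManifold (𝓡∂ (n + 1)) ∞ W] {g : W → ℝ}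
    (hg : (Cobordism.ofBoundary n W).IsMorseFunction g)
    (ξ : Cₛ^∞⟮𝓡∂ (n + 1); EuclideanSpace ℝ (Fin (n + 1)), (TangentSpace (𝓡∂ (n + 1)) : W → Type)⟯)
    (hξ : IsGradientLike (𝓡∂ (n + 1)) g ξ) {a₀ a₁ a₂ a₃ b b' : ℝ} (ha₀ : 0 < a₀)
    (ha₁₂ : a₁ < a₂) (ha₃ : a₃ < 1)
    {p p' r r' : W}
    (hp : p ∈ criticalSetOfIndex (𝓡∂ (n + 1)) g 1)
    (hp' : p' ∈ criticalSetOfIndex (𝓡∂ (n + 1)) g 2)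
    (h₁ : a₀ < g p) (h₂ : g p < b) (h₃ : b < g p') (h₄ : g p' < a₁)
    (honly : ∀ z ∈ criticalSet (𝓡∂ (n + 1)) g, g z ∈ Icc a₀ a₁ → z = p ∨ z = p') {x₀ : W}
    (hx₀ : rightHandSphere (𝓡∂ (n + 1)) g ξ p b ∩ leftHandSphere (𝓡∂ (n + 1)) g ξ p' b = {x₀})
    (htr : IsTransverseInLevel (𝓡∂ (n + 1)) (g ⁻¹' {b}) (rightHandSphere (𝓡∂ (n + 1)) g ξ p b)
      (leftHandSphere (𝓡∂ (n + 1)) g ξ p' b) x₀)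
    (hr : r ∈ criticalSetOfIndex (𝓡∂ (n + 1)) g 1)
    (hr' : r' ∈ criticalSetOfIndex (𝓡∂ (n + 1)) g 2)
    (h₅ : a₂ < g r) (h₆ : g r < b') (h₇ : b' < g r') (h₈ : g r' < a₃)
    (honly' : ∀ z ∈ criticalSet (𝓡∂ (n + 1)) g, g z ∈ Icc a₂ a₃ → z = r ∨ z = r') {y₀ : W}
    (hy₀ : rightHandSphere (𝓡∂ (n + 1)) g ξ r b' ∩ leftHandSphere (𝓡∂ (n + 1)) g ξ r' b' = {y₀})
    (htr' : IsTransverseInLevel (𝓡∂ (n + 1)) (g ⁻¹' {b'}) (rightHandSphere (𝓡∂ (n + 1)) g ξ r b')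
      (leftHandSphere (𝓡∂ (n + 1)) g ξ r' b') y₀)
    {m : ℕ} (hidx : ∀ z, IsMCriticalPt (𝓡∂ (n + 1)) g z → morseIndex (𝓡∂ (n + 1)) g z ≤ m) :
    ∃ f : W → ℝ, IsMorseAdapted (𝓡∂ (n + 1)) f ∧
      (criticalSetOfIndex (𝓡∂ (n + 1)) f 1).ncard + 2 = (criticalSetOfIndex (𝓡∂ (n + 1)) g 1).ncard ∧
      (∀ j, j ≠ 1 → j ≠ 2 → criticalSetOfIndex (𝓡∂ (n + 1)) f j = criticalSetOfIndex (𝓡∂ (n + 1)) g j) ∧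
      (∀ z, IsMCriticalPt (𝓡∂ (n + 1)) f z → morseIndex (𝓡∂ (n + 1)) f z ≤ m) := by
  obtain ⟨f, hf, hcrit, hind, hidxset⟩ :=
    exists_isMorseAdapted_cancel_two_slabs hg ξ hξ ha₀ ha₁₂ ha₃ hp hp' h₁ h₂ h₃ h₄ honly hx₀ htr
      hr hr' h₅ h₆ h₇ h₈ honly' hy₀ htr'
  have hpr : p ≠ r := fun h => by subst h; linarith
  have hfin : (criticalSetOfIndex (𝓡∂ (n + 1)) g 1).Finite :=
    (IsMorse.finite_criticalSet_holds hg.isMorse).subset (criticalSetOfIndex_subset _ g 1)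
  -- index `1`: exactly `p` and `r` are removed
  have h1 : criticalSetOfIndex (𝓡∂ (n + 1)) f 1 = criticalSetOfIndex (𝓡∂ (n + 1)) g 1 \ {p, r} := by
    rw [hidxset 1]
    ext z
    simp only [Set.mem_sdiff, mem_insert_iff, mem_singleton_iff, not_or, mem_criticalSetOfIndex]
    constructor
    · rintro ⟨hz, hzp, -, hzr, -⟩
      exact ⟨hz, hzp, hzr⟩
    · rintro ⟨hz, hzp, hzr⟩
      refine ⟨hz, hzp, ?_, hzr, ?_⟩
      · rintro rfl; have := hz.2.symm.trans hp'.2; omega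
      · rintro rfl; have := hz.2.symm.trans hr'.2; omega
  have hsub : ({p, r} : Set W) ⊆ criticalSetOfIndex (𝓡∂ (n + 1)) g 1 := by
    rintro z (rfl | rfl)
    · exact hp
    · exact hr
  refine ⟨f, hf, ?_, fun j hj1 hj2 => ?_, fun z hz => ?_⟩
  · rw [h1, ← Set.ncard_pair hpr]
    exact Set.ncard_sdiff_add_ncard_of_subset hsub hfin
  · rw [hidxset j]
    ext z
    simp only [Set.mem_sdiff, mem_insert_iff, mem_singleton_iff, not_or, mem_criticalSetOfIndex,
      and_iff_left_iff_imp]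
    rintro ⟨-, hzj⟩
    refine ⟨?_, ?_, ?_, ?_⟩
    · rintro rfl; exact hj1 (hzj.symm.trans hp.2)
    · rintro rfl; exact hj2 (hzj.symm.trans hp'.2)
    · rintro rfl; exact hj1 (hzj.symm.trans hr.2)
    · rintro rfl; exact hj2 (hzj.symm.trans hr'.2)
  · have hzc : z ∈ criticalSet (𝓡∂ (n + 1)) f := hz
    have hzg : z ∈ criticalSet (𝓡∂ (n + 1)) g := by rw [hcrit] at hzc; exact hzc.1
    rw [hind z hzc]
    exact hidx z hzg

end Slabs

end Literature.Topology.FourManifolds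

end
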